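import Mathlib
import HarnessLib
import Literature.MathematicalPhysics.KineticTheory.VelocityFlipNoise

/-!
# Momentum-parity toolkit, I: sign patterns and the pattern average
# (line `abel-storage-decay`, crux `VanishingNoiseTransfer.NoisyFourier`, stmt-AtomisticToContinuum-11977, stub B
# `stub_bulkAbelGKPositivity`; part W2 "FlipParity" of the Thomson-witness project of lead c7)

`--supports stmt-AtomisticToContinuum-11977` file. Generic pointwise bookkeeping on the phase space
`PhaseSpace L = ℝ^L × ℝ^L` of the `L`-site chain, used to evaluate the pattern average of the Liouvillian of the
Thomson witness. Notation: `F_m = momentumFlip m` (`p_m ↦ -p_m`), `σ_w x = (x.1, (± x.2 i)_i)` the momentum sign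
pattern of `w : Fin L → Bool`, `P₀ f (x) = 2^{-L} Σ_w f (σ_w x)` the PATTERN AVERAGE (written out, no definition),
"`g` is independent of `p_m`" means `∀ x t, g (x.1, x.2[m ↦ t]) = g x`. Companions: part II
(`…ThomsonWitnessParityAux1`: independence of a momentum, flip parity of partial derivatives and of the Liouvillian
terms) and part III (`…ThomsonWitnessParityAux2`: `L²`-orthogonality of opposite parities, banded Gram bound).

* `pattern_update_not`, `sum_pattern_eq_zero_of_odd`, `patternAvg_eq_zero_of_odd` — toggling the `m`-th sign is
  `F_m`; hence `P₀ f = 0` for `f` odd under one `F_m` (reindexing involution of `{0,1}^L`).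
* `apply_pattern_of_forall_even`, `apply_pattern_of_forall_sq`, `patternAvg_eq_self_of_forall_pattern`,
  `patternAvg_eq_self_of_forall_even` — `f ∘ σ_w = f` and `P₀ f = f` for `f` even under every `F_m` (e.g. a function
  of the positions and the squared momenta; atoms `ite_neg_sq`, `momentumFlip_snd_sq`).
* `patternAvg_add/_sub/_neg/_const_mul/_mul_const/_finset_sum/_const` — linearity of `P₀`.
* `odd_snd_mul_of_even`, `even_snd_mul_of_even`, `even_of_indep`, `patternAvg_snd_mul_eq_zero_of_even/_of_indep`
  (variants `patternAvg_ite_mul_eq_zero_of_even`, `patternAvg_ite_neg_mul_eq_zero_of_even` for `simp`-reduced summands) —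
  `P₀ (p_m g) = 0` when `g` is `F_m`-even, in particular when `g` is independent of `p_m`;
  `sum_snd_mul_momentumFlip_sub` — `v ∘ F_m − v = −2 p_m K_m` for `v = Σ p_{m'} K_{m'}` with `F_m`-even coefficients.
* `helper_patternAvgSndMulEqZero` — registered notation-free restatement of `patternAvg_snd_mul_eq_zero_of_indep`.

References: folklore (Fourier–Walsh parity bookkeeping on `ℤ₂^L`). No definitions; axioms `propext`,
`Classical.choice`, `Quot.sound` only.
-/

noncomputable section

open MeasureTheory
open scoped BigOperators
open Literature.MathematicalPhysics.KineticTheory.HeatConduction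

namespace Summit.AtomisticToContinuum.FouriersLaw.Theorems.NoisyFourier.ThomsonWitness.Parity

variable {L : ℕ}

/-! ## Sign patterns and the pattern average -/

/-- Toggling the `m`-th bit of a sign pattern is the momentum flip `F_m` applied after the pattern. [folklore] -/
theorem pattern_update_not (w : Fin L → Bool) (m : Fin L) (x : PhaseSpace L) :
    ((x.1, fun i => if Function.update w m (!w m) i then -x.2 i else x.2 i) : PhaseSpace L) =
      momentumFlip m (x.1, fun i => if w i then -x.2 i else x.2 i) := by
  refine Prod.ext rfl (funext fun i => ?_)
  by_cases hi : i = m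
  · subst hi
    rw [momentumFlip_snd_self]
    dsimp only
    rw [Function.update_self]
    cases w i <;> simp
  · rw [momentumFlip_snd_of_ne hi]
    dsimp only
    rw [Function.update_of_ne hi]

/-- The sum of an `F_m`-odd function over all momentum sign patterns vanishes (pair `w` with `w[m ↦ ¬ w_m]`).
[folklore] -/
theorem sum_pattern_eq_zero_of_odd (m : Fin L) {f : PhaseSpace L → ℝ} (hf : ∀ x, f (momentumFlip m x) = -f x)
    (x : PhaseSpace L) : ∑ w : Fin L → Bool, f (x.1, fun i => if w i then -x.2 i else x.2 i) = 0 := by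
  set g : (Fin L → Bool) → ℝ := fun w => f (x.1, fun i => if w i then -x.2 i else x.2 i) with hg
  have hτ : Function.Involutive (fun w : Fin L → Bool => Function.update w m (!w m)) := by
    intro w
    simp
  have h1 : ∑ w : Fin L → Bool, g (Function.update w m (!w m)) = ∑ w, g w := by
    have h := Equiv.sum_comp (Function.Involutive.toPerm _ hτ) g
    simpa only [Function.Involutive.coe_toPerm] using h
  have h2 : ∀ w : Fin L → Bool, g (Function.update w m (!w m)) = -g w := by
    intro w
    simp only [hg]
    rw [pattern_update_not, hf]
  have h3 : ∑ w : Fin L → Bool, g w = -∑ w : Fin L → Bool, g w :=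
    calc ∑ w : Fin L → Bool, g w = ∑ w : Fin L → Bool, g (Function.update w m (!w m)) := h1.symm
      _ = ∑ w : Fin L → Bool, -g w := Finset.sum_congr rfl fun w _ => h2 w
      _ = -∑ w : Fin L → Bool, g w := by simp only [Finset.sum_neg_distrib]
  linarith

/-- **`P₀ f = 0` for `f` odd under one momentum flip.** [folklore] -/
theorem patternAvg_eq_zero_of_odd (m : Fin L) {f : PhaseSpace L → ℝ} (hf : ∀ x, f (momentumFlip m x) = -f x)
    (x : PhaseSpace L) : (∑ w : Fin L → Bool, f (x.1, fun i => if w i then -x.2 i else x.2 i)) / 2 ^ L = 0 := by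
  rw [sum_pattern_eq_zero_of_odd m hf x, zero_div]

/-- A function even under every momentum flip is invariant under every momentum sign pattern. [folklore] -/
theorem apply_pattern_of_forall_even {f : PhaseSpace L → ℝ} (hf : ∀ (m : Fin L) (x : PhaseSpace L), f (momentumFlip m x) = f x)
    (w : Fin L → Bool) (x : PhaseSpace L) : f (x.1, fun i => if w i then -x.2 i else x.2 i) = f x := by
  suffices h : ∀ k : ℕ, f (x.1, fun i => if w i ∧ i.val < k then -x.2 i else x.2 i) = f x by
    have hL := h L
    simpa only [Fin.isLt, and_true] using hL
  intro k
  induction k with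
  | zero =>
    congr 1
    exact Prod.ext rfl (funext fun i => by simp)
  | succ k ih =>
    by_cases hk : ∃ m : Fin L, m.val = k ∧ w m = true
    · obtain ⟨m, hm, hwm⟩ := hk
      have hpt : ((x.1, fun i => if w i ∧ i.val < k + 1 then -x.2 i else x.2 i) : PhaseSpace L) =
          momentumFlip m (x.1, fun i => if w i ∧ i.val < k then -x.2 i else x.2 i) := by
        refine Prod.ext rfl (funext fun i => ?_)
        by_cases hi : i = m
        · subst hi
          rw [momentumFlip_snd_self]
          simp [hwm, hm]
        · rw [momentumFlip_snd_of_ne hi]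
          have hik : i.val ≠ k := fun h => hi (Fin.ext (h.trans hm.symm))
          have hiff : i.val < k + 1 ↔ i.val < k := by omega
          dsimp only
          simp only [hiff]
      rw [hpt, hf, ih]
    · have hpt : ((x.1, fun i => if w i ∧ i.val < k + 1 then -x.2 i else x.2 i) : PhaseSpace L) =
          (x.1, fun i => if w i ∧ i.val < k then -x.2 i else x.2 i) := by
        refine Prod.ext rfl (funext fun i => ?_)
        dsimp only
        by_cases hik : i.val = k
        · have hwi : ¬ w i = true := fun h => hk ⟨i, hik, h⟩
          simp [hwi]
        · have hiff : i.val < k + 1 ↔ i.val < k := by omega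
          simp only [hiff]
      rw [hpt, ih]

/-- The square of a momentum is invariant under every sign pattern. [folklore] -/
theorem ite_neg_sq (w : Fin L → Bool) (x : PhaseSpace L) (k : Fin L) :
    (if w k then -x.2 k else x.2 k) ^ 2 = x.2 k ^ 2 := by
  split <;> ring

/-- The square of a momentum is invariant under every momentum flip. [folklore] -/
theorem momentumFlip_snd_sq (m k : Fin L) (x : PhaseSpace L) : (momentumFlip m x).2 k ^ 2 = x.2 k ^ 2 := by
  by_cases hk : k = m
  · subst hk
    rw [momentumFlip_snd_self, neg_sq]
  · rw [momentumFlip_snd_of_ne hk]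

/-- A function of the positions and of the SQUARES of the momenta is invariant under every sign pattern.
[folklore] -/
theorem apply_pattern_of_forall_sq {f : PhaseSpace L → ℝ}
    (hf : ∀ x y : PhaseSpace L, y.1 = x.1 → (∀ i, y.2 i ^ 2 = x.2 i ^ 2) → f y = f x)
    (w : Fin L → Bool) (x : PhaseSpace L) : f (x.1, fun i => if w i then -x.2 i else x.2 i) = f x :=
  hf x _ rfl fun i => ite_neg_sq w x i

/-- A function of the positions and of the squares of the momenta is even under every momentum flip. [folklore] -/
theorem apply_momentumFlip_of_forall_sq {f : PhaseSpace L → ℝ}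
    (hf : ∀ x y : PhaseSpace L, y.1 = x.1 → (∀ i, y.2 i ^ 2 = x.2 i ^ 2) → f y = f x)
    (m : Fin L) (x : PhaseSpace L) : f (momentumFlip m x) = f x :=
  hf x _ rfl fun i => momentumFlip_snd_sq m i x

/-- `P₀ f (x) = f x` as soon as `f (σ_w x) = f x` for every pattern `w`. [folklore] -/
theorem patternAvg_eq_self_of_forall_pattern {f : PhaseSpace L → ℝ} {x : PhaseSpace L}
    (hf : ∀ w : Fin L → Bool, f (x.1, fun i => if w i then -x.2 i else x.2 i) = f x) :
    (∑ w : Fin L → Bool, f (x.1, fun i => if w i then -x.2 i else x.2 i)) / 2 ^ L = f x := by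
  rw [Finset.sum_congr rfl fun w _ => hf w, Finset.sum_const, Finset.card_univ, Fintype.card_fun,
    Fintype.card_bool, Fintype.card_fin, nsmul_eq_mul, Nat.cast_pow, Nat.cast_ofNat,
    mul_div_cancel_left₀ _ (pow_ne_zero L (two_ne_zero : (2 : ℝ) ≠ 0))]

/-- **`P₀ f = f` for `f` even under every momentum flip.** [folklore] -/
theorem patternAvg_eq_self_of_forall_even {f : PhaseSpace L → ℝ} (hf : ∀ (m : Fin L) (x : PhaseSpace L), f (momentumFlip m x) = f x)
    (x : PhaseSpace L) : (∑ w : Fin L → Bool, f (x.1, fun i => if w i then -x.2 i else x.2 i)) / 2 ^ L = f x :=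
  patternAvg_eq_self_of_forall_pattern fun w => apply_pattern_of_forall_even hf w x

/-- `P₀` of a pattern-independent summand (a constant, a function of the positions `x.1` only, …). [folklore] -/
theorem patternAvg_const (L : ℕ) (c : ℝ) : (∑ _w : Fin L → Bool, c) / 2 ^ L = c := by
  rw [Finset.sum_const, Finset.card_univ, Fintype.card_fun, Fintype.card_bool, Fintype.card_fin, nsmul_eq_mul,
    Nat.cast_pow, Nat.cast_ofNat, mul_div_cancel_left₀ _ (pow_ne_zero L (two_ne_zero : (2 : ℝ) ≠ 0))]

/-- Linearity of `P₀`: sums. [folklore] -/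
theorem patternAvg_add (f g : PhaseSpace L → ℝ) (x : PhaseSpace L) :
    (∑ w : Fin L → Bool, (f (x.1, fun i => if w i then -x.2 i else x.2 i) + g (x.1, fun i => if w i then -x.2 i else x.2 i))) / 2 ^ L =
      (∑ w : Fin L → Bool, f (x.1, fun i => if w i then -x.2 i else x.2 i)) / 2 ^ L +
        (∑ w : Fin L → Bool, g (x.1, fun i => if w i then -x.2 i else x.2 i)) / 2 ^ L := by
  rw [Finset.sum_add_distrib, add_div]

/-- Linearity of `P₀`: differences. [folklore] -/
theorem patternAvg_sub (f g : PhaseSpace L → ℝ) (x : PhaseSpace L) :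
    (∑ w : Fin L → Bool, (f (x.1, fun i => if w i then -x.2 i else x.2 i) - g (x.1, fun i => if w i then -x.2 i else x.2 i))) / 2 ^ L =
      (∑ w : Fin L → Bool, f (x.1, fun i => if w i then -x.2 i else x.2 i)) / 2 ^ L -
        (∑ w : Fin L → Bool, g (x.1, fun i => if w i then -x.2 i else x.2 i)) / 2 ^ L := by
  rw [Finset.sum_sub_distrib, sub_div]

/-- Linearity of `P₀`: negation. [folklore] -/
theorem patternAvg_neg (f : PhaseSpace L → ℝ) (x : PhaseSpace L) :
    (∑ w : Fin L → Bool, -f (x.1, fun i => if w i then -x.2 i else x.2 i)) / 2 ^ L =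
      -((∑ w : Fin L → Bool, f (x.1, fun i => if w i then -x.2 i else x.2 i)) / 2 ^ L) := by
  rw [Finset.sum_neg_distrib, neg_div]

/-- Linearity of `P₀`: left scalar factors (the factor may depend on `x`, e.g. a function of `x.1`). [folklore] -/
theorem patternAvg_const_mul (c : ℝ) (f : PhaseSpace L → ℝ) (x : PhaseSpace L) :
    (∑ w : Fin L → Bool, c * f (x.1, fun i => if w i then -x.2 i else x.2 i)) / 2 ^ L =
      c * ((∑ w : Fin L → Bool, f (x.1, fun i => if w i then -x.2 i else x.2 i)) / 2 ^ L) := by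
  rw [← Finset.mul_sum, mul_div_assoc]

/-- Linearity of `P₀`: right scalar factors. [folklore] -/
theorem patternAvg_mul_const (f : PhaseSpace L → ℝ) (c : ℝ) (x : PhaseSpace L) :
    (∑ w : Fin L → Bool, f (x.1, fun i => if w i then -x.2 i else x.2 i) * c) / 2 ^ L =
      (∑ w : Fin L → Bool, f (x.1, fun i => if w i then -x.2 i else x.2 i)) / 2 ^ L * c := by
  rw [← Finset.sum_mul, div_mul_eq_mul_div]

/-- Linearity of `P₀`: finite sums. [folklore] -/
theorem patternAvg_finset_sum {ι : Type*} (s : Finset ι) (f : ι → PhaseSpace L → ℝ) (x : PhaseSpace L) :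
    (∑ w : Fin L → Bool, ∑ k ∈ s, f k (x.1, fun i => if w i then -x.2 i else x.2 i)) / 2 ^ L =
      ∑ k ∈ s, (∑ w : Fin L → Bool, f k (x.1, fun i => if w i then -x.2 i else x.2 i)) / 2 ^ L := by
  rw [Finset.sum_comm, Finset.sum_div]

/-! ## `P₀ (p_m · g) = 0` for `g` even in `p_m` -/

/-- `p_m g` is `F_m`-odd when `g` is `F_m`-even. [folklore] -/
theorem odd_snd_mul_of_even (m : Fin L) {g : PhaseSpace L → ℝ} (hg : ∀ x, g (momentumFlip m x) = g x)
    (x : PhaseSpace L) : (momentumFlip m x).2 m * g (momentumFlip m x) = -(x.2 m * g x) := by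
  rw [momentumFlip_snd_self, hg, neg_mul]

/-- `p_k g` is `F_m`-even when `g` is and `k ≠ m`. [folklore] -/
theorem even_snd_mul_of_even {m k : Fin L} (hkm : k ≠ m) {g : PhaseSpace L → ℝ}
    (hg : ∀ x, g (momentumFlip m x) = g x) (x : PhaseSpace L) :
    (momentumFlip m x).2 k * g (momentumFlip m x) = x.2 k * g x := by
  rw [momentumFlip_snd_of_ne hkm, hg]

/-- A function independent of `p_m` is `F_m`-even. [folklore] -/
theorem even_of_indep (m : Fin L) {g : PhaseSpace L → ℝ}
    (hg : ∀ (x : PhaseSpace L) (t : ℝ), g (x.1, Function.update x.2 m t) = g x) (x : PhaseSpace L) :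
    g (momentumFlip m x) = g x :=
  hg x (-x.2 m)

/-- A function independent of `p_m` is `F_m`-odd only if it vanishes; contrapositive bookkeeping: `p_m g` is
`F_m`-odd for `g` independent of `p_m`. [folklore] -/
theorem odd_snd_mul_of_indep (m : Fin L) {g : PhaseSpace L → ℝ}
    (hg : ∀ (x : PhaseSpace L) (t : ℝ), g (x.1, Function.update x.2 m t) = g x) (x : PhaseSpace L) :
    (momentumFlip m x).2 m * g (momentumFlip m x) = -(x.2 m * g x) :=
  odd_snd_mul_of_even m (even_of_indep m hg) x

/-- **`P₀ (p_m g) = 0` for `g` even under `F_m`** (projection form of the summand). [folklore] -/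
theorem patternAvg_snd_mul_eq_zero_of_even (m : Fin L) {g : PhaseSpace L → ℝ}
    (hg : ∀ x, g (momentumFlip m x) = g x) (x : PhaseSpace L) :
    (∑ w : Fin L → Bool, ((x.1, fun i => if w i then -x.2 i else x.2 i) : PhaseSpace L).2 m *
        g (x.1, fun i => if w i then -x.2 i else x.2 i)) / 2 ^ L = 0 :=
  patternAvg_eq_zero_of_odd m (f := fun y => y.2 m * g y) (odd_snd_mul_of_even m hg) x

/-- `P₀ (p_m g) = 0` for `g` even under `F_m` (reduced form of the summand). [folklore] -/
theorem patternAvg_ite_mul_eq_zero_of_even (m : Fin L) {g : PhaseSpace L → ℝ}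
    (hg : ∀ x, g (momentumFlip m x) = g x) (x : PhaseSpace L) :
    (∑ w : Fin L → Bool, (if w m then -x.2 m else x.2 m) * g (x.1, fun i => if w i then -x.2 i else x.2 i)) / 2 ^ L = 0 :=
  patternAvg_snd_mul_eq_zero_of_even m hg x

/-- `P₀ (p_m g) = 0` for `g` even under `F_m` (`simp`-normal form of the summand, the sign pushed through the
product). [folklore] -/
theorem patternAvg_ite_neg_mul_eq_zero_of_even (m : Fin L) {g : PhaseSpace L → ℝ}
    (hg : ∀ x, g (momentumFlip m x) = g x) (x : PhaseSpace L) :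
    (∑ w : Fin L → Bool, (if w m then -(x.2 m * g (x.1, fun i => if w i then -x.2 i else x.2 i))
      else x.2 m * g (x.1, fun i => if w i then -x.2 i else x.2 i))) / 2 ^ L = 0 := by
  rw [← patternAvg_ite_mul_eq_zero_of_even m hg x]
  congr 1
  refine Finset.sum_congr rfl fun w _ => ?_
  split <;> ring

/-- **`P₀ (p_m g) = 0` for `g` independent of `p_m`.** [folklore] -/
theorem patternAvg_snd_mul_eq_zero_of_indep (m : Fin L) {g : PhaseSpace L → ℝ}
    (hg : ∀ (x : PhaseSpace L) (t : ℝ), g (x.1, Function.update x.2 m t) = g x) (x : PhaseSpace L) :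
    (∑ w : Fin L → Bool, ((x.1, fun i => if w i then -x.2 i else x.2 i) : PhaseSpace L).2 m *
        g (x.1, fun i => if w i then -x.2 i else x.2 i)) / 2 ^ L = 0 :=
  patternAvg_snd_mul_eq_zero_of_even m (even_of_indep m hg) x

/-- The flip defect of `v = Σ_{m'} p_{m'} K_{m'}` with every `K_{m'}` even under `F_m`:
`v ∘ F_m − v = −2 p_m K_m`. [folklore] -/
theorem sum_snd_mul_momentumFlip_sub (m : Fin L) (K : Fin L → PhaseSpace L → ℝ)
    (hK : ∀ m' x, K m' (momentumFlip m x) = K m' x) (x : PhaseSpace L) :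
    ∑ m', (momentumFlip m x).2 m' * K m' (momentumFlip m x) - ∑ m', x.2 m' * K m' x = -2 * (x.2 m * K m x) := by
  rw [← Finset.sum_sub_distrib, Finset.sum_eq_single m]
  · rw [momentumFlip_snd_self, hK]
    ring
  · intro m' _ hm'
    rw [momentumFlip_snd_of_ne hm', hK, sub_self]
  · intro h
    exact absurd (Finset.mem_univ m) h

/-! ## Registered helper (notation-free restatement) -/

/-- Registered helper sub-goal `helper_patternAvgSndMulEqZero` of crux stmt-AtomisticToContinuum-11977 (line
`abel-storage-decay`, stub B `stub_bulkAbelGKPositivity`, part W2): the pattern average of `p_m g` vanishes for every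
`g` independent of `p_m` (`patternAvg_snd_mul_eq_zero_of_indep`, restated). [folklore] -/
theorem helper_patternAvgSndMulEqZero : ∀ (L : ℕ) (m : Fin L) (g : Literature.MathematicalPhysics.KineticTheory.HeatConduction.PhaseSpace L → ℝ), (∀ (x : Literature.MathematicalPhysics.KineticTheory.HeatConduction.PhaseSpace L) (t : ℝ), g (x.1, Function.update x.2 m t) = g x) → ∀ x : Literature.MathematicalPhysics.KineticTheory.HeatConduction.PhaseSpace L, (∑ w : Fin L → Bool, ((x.1, fun i => if w i then -x.2 i else x.2 i) : Literature.MathematicalPhysics.KineticTheory.HeatConduction.PhaseSpace L).2 m * g (x.1, fun i => if w i then -x.2 i else x.2 i)) / 2 ^ L = 0 :=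
  fun _ m _ hg x => patternAvg_snd_mul_eq_zero_of_indep m hg x

end Summit.AtomisticToContinuum.FouriersLaw.Theorems.NoisyFourier.ThomsonWitness.Parity

end
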